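import Mathlib
import Summits.Ventures.PercRepro2.Defs
import Summits.Ventures.PercRepro2.Graph
import Summits.Ventures.PercRepro2.Induced
import Summits.Ventures.PercRepro2.VdBKahn
import Summits.Ventures.PercRepro2.ReimerVdBK
import Summits.Ventures.PercRepro2.ReimerVdBKRegions
import Summits.Ventures.PercRepro2.ReimerVdBKZClosed
import Summits.Ventures.PercRepro2.ReimerVdBKZReduction
import Summits.Ventures.PercRepro2.ReimerVdBKZSplit
import Summits.Ventures.PercRepro2.ReimerVdBKZRecursion

/-!
# The recursion with pendant unmarked neighbours
(blind cell PercRepro2, mine-c g46; `conjectures/MINE-C.md` §55.5)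

`ReimerVdBKZRecursion` runs the one-edge recursion of (R-1.2) as long as every neighbour of a doubly-avoided
vertex is marked.  An UNMARKED neighbour `y` whose only non-loop edge is the edge `e = {z, y}` being split
is harmless too: after the split `y` is isolated, hence never reached, and the two sub-instances are the
instance itself (`rvdBK_split_pendant`).  THEOREM `rvdBK_of_closed_marked_pendant`: (R-1.2) holds whenever
`T ⊇ X ∩ Y` is closed under adjacency into `(X ∪ Y) ∖ (A ∪ B)` and every non-loop edge at a vertex of `T`
leads to the root, a marked vertex, or a vertex with no other non-loop edge.  Reach (`MINE-C.md` §55.5):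
90.9 % / 83.3 % of the `Z ≠ ∅` instances on 4 / 5 vertices, against 87.6 % / 80.6 % without the pendant
clause — the first kernel theorem admitting unmarked neighbours of `Z`.
-/

namespace Summit.Ventures.PercRepro2
namespace ReimerVdBK
open Classical

variable {V : Type*} {E : Type*} [Fintype E] [DecidableEq E] [Fintype V] [DecidableEq V]
variable (ends : E → Sym2 V) (s : V)

omit [Fintype E] [DecidableEq E] [Fintype V] [DecidableEq V] in
/-- «`y` is pendant at `e`»: every non-loop edge at `y` is `e`. -/
def PendantAt (y : V) (e : E) : Prop := ∀ f, y ∈ ends f → ¬ (ends f).IsDiag → f = e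

omit [Fintype E] [Fintype V] [DecidableEq V] in
/-- After looping `e`, a vertex pendant at `e` carries only loops. -/
lemma loopAt_inert_of_pendant {y z : V} {e : E} (hyz : y ≠ z) (hp : PendantAt ends y e) :
    ∀ f, y ∈ loopAt ends e z f → (loopAt ends e z f).IsDiag := by
  intro f hf
  by_cases hfe : f = e
  · subst hfe
    rw [loopAt_apply_self] at hf ⊢
    rw [Sym2.mem_iff] at hf
    exact absurd (hf.elim id id) hyz
  · rw [loopAt_apply_of_ne ends hfe] at hf ⊢
    by_contra hnd
    exact hfe (hp f hf hnd)

omit [Fintype V] in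
/-- An inert vertex may be added to or removed from the avoided sets freely. -/
lemma reimerCount_insert_inert {y : V} (hsy : s ≠ y) (hy : ∀ e, y ∈ ends e → (ends e).IsDiag)
    (A X B Y : Finset V) :
    reimerCount ends s A (insert y X) B Y = reimerCount ends s A X B Y ∧
      reimerCount ends s A X B (insert y Y) = reimerCount ends s A X B Y := by
  have hT : ∀ z ∈ ({y} : Finset V), s ≠ z ∧ ∀ e, z ∈ ends e → (ends e).IsDiag := by
    intro z hz
    rw [Finset.mem_singleton] at hz
    subst hz
    exact ⟨hsy, hy⟩
  have h1 := reimerCount_sdiff_of_inert ends s {y} hT A (insert y X) B Y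
  have h2 := reimerCount_sdiff_of_inert ends s {y} hT A X B (insert y Y)
  have h0 := reimerCount_sdiff_of_inert ends s {y} hT A X B Y
  have e1 : insert y X \ {y} = X \ {y} := by
    ext v; simp only [Finset.mem_sdiff, Finset.mem_insert, Finset.mem_singleton]; tauto
  have e2 : insert y Y \ {y} = Y \ {y} := by
    ext v; simp only [Finset.mem_sdiff, Finset.mem_insert, Finset.mem_singleton]; tauto
  rw [e1] at h1
  rw [e2] at h2
  exact ⟨h1.trans h0.symm, h2.trans h0.symm⟩

omit [Fintype V] in
/-- **The recursion step at a pendant unmarked neighbour**: if the only non-loop edge at the unmarked vertex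
`y ≠ s` is `e = {z, y}`, `z ∈ X ∩ Y`, then (R-1.2) on the looped graph for `(A, X; B, Y)` gives (R-1.2) on
`G` for `(A, X; B, Y)`. -/
theorem rvdBK_split_pendant {z y : V} {e : E} (hends : ends e = s(z, y)) (hsz : s ≠ z) (hsy : s ≠ y)
    (hyz : y ≠ z) {A X B Y : Finset V} (hzX : z ∈ X) (hzY : z ∈ Y) (hp : PendantAt ends y e)
    (h : RvdBK (loopAt ends e z) s A X B Y) : RvdBK ends s A X B Y := by
  have hL := reimerCount_split ends s hends hsz (A := A) (B := B) hzX hzY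
  have hR := reimerCount_split ends s hends hsz (A := A ∪ B) (X := X ∩ Y) (B := ∅) (Y := X ∪ Y)
    (Finset.mem_inter.2 ⟨hzX, hzY⟩) (Finset.mem_union_left _ hzX)
  have hin := loopAt_inert_of_pendant ends hyz hp
  have i1 := reimerCount_insert_inert (loopAt ends e z) s hsy hin A X B Y
  have i2 := reimerCount_insert_inert (loopAt ends e z) s hsy hin (A ∪ B) (X ∩ Y) ∅ (X ∪ Y)
  unfold RvdBK at h ⊢
  rw [i1.1, i1.2] at hL
  rw [i2.1, i2.2] at hR
  omega

/-- **(R-1.2) by recursion with pendant unmarked neighbours.**  Let `A ∩ X = B ∩ Y = ∅` and let `T` be a set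
of vertices with `X ∩ Y ⊆ T` such that (i) every non-loop edge `{z, y}` at a vertex `z ∈ T` leads to the
root, to a marked vertex, or to a vertex `y` whose only non-loop edge is that edge, and (ii) `T` is closed
under adjacency into `(X ∪ Y) ∖ (A ∪ B)`.  Then `Φ(A, X; B, Y) ≤ Φ(A ∪ B, X ∩ Y; ∅, X ∪ Y)`. -/
theorem rvdBK_of_closed_marked_pendant (T : Finset V) {A X B Y : Finset V} (hAX : Disjoint A X)
    (hBY : Disjoint B Y) (hZT : X ∩ Y ⊆ T)
    (hTm : ∀ e z y, ends e = s(z, y) → z ∈ T → y ≠ z →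
      y = s ∨ y ∈ A ∪ B ∪ X ∪ Y ∨ PendantAt ends y e)
    (hTc : ∀ e z y, ends e = s(z, y) → z ∈ T → y ∈ (X ∪ Y) \ (A ∪ B) → y ∈ T) :
    RvdBK ends s A X B Y := by
  suffices H : ∀ N : ℕ, ∀ (ends : E → Sym2 V) (A X B Y : Finset V), (nonloop ends).card = N →
      Disjoint A X → Disjoint B Y → X ∩ Y ⊆ T →
      (∀ e z y, ends e = s(z, y) → z ∈ T → y ≠ z → y = s ∨ y ∈ A ∪ B ∪ X ∪ Y ∨ PendantAt ends y e) →
      (∀ e z y, ends e = s(z, y) → z ∈ T → y ∈ (X ∪ Y) \ (A ∪ B) → y ∈ T) →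
      RvdBK ends s A X B Y from H _ ends A X B Y rfl hAX hBY hZT hTm hTc
  intro N
  induction N using Nat.strong_induction_on with
  | _ N ih =>
  intro ends A X B Y hN hAX hBY hZT hTm hTc
  by_cases hsZ : s ∈ X ∩ Y
  · unfold RvdBK
    rw [reimerCount_eq_zero_of_root_mem_X ends s A (Finset.mem_inter.1 hsZ).1 B Y]
    exact Nat.zero_le _
  by_cases hact : ∃ e z y, ends e = s(z, y) ∧ z ∈ X ∩ Y ∧ y ≠ z
  · obtain ⟨e, z, y, hends, hzZ, hyz⟩ := hact
    obtain ⟨hzX, hzY⟩ := Finset.mem_inter.1 hzZ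
    have hsz : s ≠ z := fun h => hsZ (by rw [h]; exact hzZ)
    have hzT : z ∈ T := hZT hzZ
    have hne : ¬ (ends e).IsDiag := by
      rw [hends, Sym2.mk_isDiag_iff]; exact fun h => hyz h.symm
    have hcard : (nonloop (loopAt ends e z)).card < N := by
      rw [← hN]; exact card_nonloop_loopAt_lt ends hne z
    -- facts about the looped graph
    have hfe_of : ∀ f z' y', loopAt ends e z f = s(z', y') → y' ≠ z' → f ≠ e := by
      intro f z' y' hf hy'z' hfe
      rw [hfe, loopAt_apply_self, Sym2.eq_iff] at hf
      rcases hf with ⟨h1, h2⟩ | ⟨h1, h2⟩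
      · exact hy'z' (h2.symm.trans h1)
      · exact hy'z' (h1.symm.trans h2)
    have hpend' : ∀ f y', PendantAt ends y' f → PendantAt (loopAt ends e z) y' f := by
      intro f y' hp g hg hnd
      by_cases hge : g = e
      · subst hge
        rw [loopAt_apply_self] at hnd
        exact absurd (Sym2.mk_isDiag_iff.2 rfl) hnd
      · rw [loopAt_apply_of_ne ends hge] at hg hnd
        exact hp g hg hnd
    have hTm' : ∀ (X' Y' : Finset V), X ⊆ X' → Y ⊆ Y' →
        ∀ f z' y', loopAt ends e z f = s(z', y') → z' ∈ T → y' ≠ z' →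
          y' = s ∨ y' ∈ A ∪ B ∪ X' ∪ Y' ∨ PendantAt (loopAt ends e z) y' f := by
      intro X' Y' hX' hY' f z' y' hf hz'T hy'z'
      have hfe := hfe_of f z' y' hf hy'z'
      rw [loopAt_apply_of_ne ends hfe] at hf
      rcases hTm f z' y' hf hz'T hy'z' with h | h | h
      · exact Or.inl h
      · right; left
        simp only [Finset.mem_union] at h ⊢
        rcases h with ((h | h) | h) | h
        · exact Or.inl (Or.inl (Or.inl h))
        · exact Or.inl (Or.inl (Or.inr h))
        · exact Or.inl (Or.inr (hX' h))
        · exact Or.inr (hY' h)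
      · exact Or.inr (Or.inr (hpend' f y' h))
    -- an edge of the looped graph at `z' ∈ T` towards a purely avoided `y' ≠ y` is an original edge
    have hTc_ne : ∀ f z' y', loopAt ends e z f = s(z', y') → z' ∈ T → y' ≠ y →
        y' ∈ (X ∪ Y) \ (A ∪ B) → y' ∈ T := by
      intro f z' y' hf hz'T hy'y hy'
      by_cases hfe : f = e
      · subst hfe
        rw [loopAt_apply_self, Sym2.eq_iff] at hf
        have hy'z : y' = z := by
          rcases hf with ⟨_, h2⟩ | ⟨h1, _⟩
          · exact h2.symm
          · exact h1.symm
        rw [hy'z]; exact hzT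
      · rw [loopAt_apply_of_ne ends hfe] at hf
        exact hTc f z' y' hf hz'T hy'
    by_cases hys : y = s
    · -- the root: both sub-instances are empty
      refine rvdBK_split ends s hends hsz hzX hzY hAX hBY (Or.inl hys) ?_ ?_
      · intro hys' _; exact absurd hys hys'
      · intro hys' _; exact absurd hys hys'
    by_cases hyM : y ∈ A ∪ B ∪ X ∪ Y
    · -- a marked neighbour: the recursion step of `ReimerVdBKZSplit`
      have hy : y = s ∨ y = z ∨ y ∈ A ∨ y ∈ B ∨ y ∈ X ∨ y ∈ Y := by
        simp only [Finset.mem_union] at hyM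
        rcases hyM with ((h | h) | h) | h
        · exact Or.inr (Or.inr (Or.inl h))
        · exact Or.inr (Or.inr (Or.inr (Or.inl h)))
        · exact Or.inr (Or.inr (Or.inr (Or.inr (Or.inl h))))
        · exact Or.inr (Or.inr (Or.inr (Or.inr (Or.inr h))))
      have hyT : y ∉ A → y ∉ B → y ∈ T := by
        intro hyA hyB
        refine hTc e z y hends hzT ?_
        rw [Finset.mem_sdiff, Finset.mem_union, Finset.mem_union]
        simp only [Finset.mem_union] at hyM
        refine ⟨?_, fun h => h.elim hyA hyB⟩
        rcases hyM with ((h | h) | h) | h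
        · exact absurd h hyA
        · exact absurd h hyB
        · exact Or.inl h
        · exact Or.inr h
      refine rvdBK_split ends s hends hsz hzX hzY hAX hBY hy ?_ ?_
      · intro _ hyA
        refine ih _ hcard (loopAt ends e z) A (insert y X) B Y rfl
          (Finset.disjoint_insert_right.2 ⟨hyA, hAX⟩) hBY ?_ (hTm' (insert y X) Y (Finset.subset_insert y X)
            (Finset.Subset.refl Y)) ?_
        · intro v hv
          rw [Finset.mem_inter, Finset.mem_insert] at hv
          rcases hv with ⟨hv1 | hv1, hv2⟩
          · rw [hv1] at hv2 ⊢
            exact hyT hyA (fun h => Finset.disjoint_left.1 hBY h hv2)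
          · exact hZT (Finset.mem_inter.2 ⟨hv1, hv2⟩)
        · intro f z' y' hf hz'T hy'
          by_cases hy'y : y' = y
          · rw [hy'y] at hy' ⊢
            rw [Finset.mem_sdiff, Finset.mem_union] at hy'
            exact hyT hyA (fun h => hy'.2 (Finset.mem_union_right _ h))
          · refine hTc_ne f z' y' hf hz'T hy'y ?_
            rw [Finset.mem_sdiff, Finset.mem_union, Finset.mem_insert] at hy'
            rw [Finset.mem_sdiff, Finset.mem_union]
            rcases hy'.1 with (h | h) | h
            · exact absurd h hy'y
            · exact ⟨Or.inl h, hy'.2⟩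
            · exact ⟨Or.inr h, hy'.2⟩
      · intro _ hyB
        refine ih _ hcard (loopAt ends e z) A X B (insert y Y) rfl hAX
          (Finset.disjoint_insert_right.2 ⟨hyB, hBY⟩) ?_ (hTm' X (insert y Y) (Finset.Subset.refl X)
            (Finset.subset_insert y Y)) ?_
        · intro v hv
          rw [Finset.mem_inter, Finset.mem_insert] at hv
          rcases hv with ⟨hv1, hv2 | hv2⟩
          · rw [hv2] at hv1 ⊢
            exact hyT (fun h => Finset.disjoint_left.1 hAX h hv1) hyB
          · exact hZT (Finset.mem_inter.2 ⟨hv1, hv2⟩)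
        · intro f z' y' hf hz'T hy'
          by_cases hy'y : y' = y
          · rw [hy'y] at hy' ⊢
            rw [Finset.mem_sdiff, Finset.mem_union] at hy'
            exact hyT (fun h => hy'.2 (Finset.mem_union_left _ h)) hyB
          · refine hTc_ne f z' y' hf hz'T hy'y ?_
            rw [Finset.mem_sdiff, Finset.mem_union, Finset.mem_insert] at hy'
            rw [Finset.mem_sdiff, Finset.mem_union]
            rcases hy'.1 with h | (h | h)
            · exact ⟨Or.inl h, hy'.2⟩
            · exact absurd h hy'y
            · exact ⟨Or.inr h, hy'.2⟩
    · -- an unmarked neighbour: by `hTm` it is pendant at `e`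
      have hyp : PendantAt ends y e := by
        rcases hTm e z y hends hzT hyz with h | h | h
        · exact absurd h hys
        · exact absurd h hyM
        · exact h
      have hsy : s ≠ y := fun h => hys h.symm
      refine rvdBK_split_pendant ends s hends hsz hsy hyz hzX hzY hyp ?_
      refine ih _ hcard (loopAt ends e z) A X B Y rfl hAX hBY hZT
        (hTm' X Y (Finset.Subset.refl X) (Finset.Subset.refl Y)) ?_
      intro f z' y' hf hz'T hy'
      by_cases hy'y : y' = y
      · -- `y` is purely avoided only if marked — it is not
        rw [hy'y] at hy'
        rw [Finset.mem_sdiff, Finset.mem_union] at hy'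
        exact absurd (by
          rcases hy'.1 with h | h
          · exact Finset.mem_union_left _ (Finset.mem_union_right _ h)
          · exact Finset.mem_union_right _ h) hyM
      · exact hTc_ne f z' y' hf hz'T hy'y hy'
  · push Not at hact
    refine rvdBK_of_inert ends s fun z hz => ⟨fun h => hsZ (by rw [h]; exact hz), fun e he => ?_⟩
    obtain ⟨y, hy⟩ := Sym2.mem_iff_exists.1 he
    rw [hy, Sym2.mk_isDiag_iff]
    exact (hact e z y hy hz).symm

end ReimerVdBK
end Summit.Ventures.PercRepro2
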